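import Summits.AtomisticToContinuum.FouriersLaw.Theorems.BondHeatUncertaintyExtensiveSnapshotIrreversibilityEnergyWindowChain
import Summits.AtomisticToContinuum.FouriersLaw.Theorems.BondHeatUncertaintyExtensiveSnapshotIrreversibilityEnergyWindowAtoms

/-!
# Crux `ExtensiveSnapshotIrreversibility` (stmt-AtomisticToContinuum-9121), fixed-`N` half `K_fix`:
the atoms sit BELOW the regularity package of record, and three of them are NECESSARY for `(W)`

(helper file, theorem-side; imports `…EnergyWindowChain` (`(R)` = `LogDensityRegularity`,
`(R) ⟹ (W)`) and `…EnergyWindowAtoms` (the five atoms `A0 … A4` and the glue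
`A0 → A1 → A2 → A3 → A4 → (W)`).)

The atoms `A1 NessExpMomentBound`, `A2 NessOddLogRatioBound`, `A3 NessDensityFloor`,
`A4 NessLinearResponseL2` were typed (universal / almost-everywhere / Radon–Nikodym form) so that they
do not depend on a chosen representative of the log-density.  This file records the two cheap
directions that place them on the ladder:

* §1 `ae_eq_of_withDensity_exp_eq`: two measurable exponents `φ, ψ` with
  `μ₀ · e^{φ} = μ₀ · e^{ψ}` agree `μ₀`-a.e. (Radon–Nikodym derivative of a `withDensity` measure);
  the momentum flip is quasi-measure-preserving for the Gibbs state.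
* §2 `(W) ⟹ A1`, `(W) ⟹ A2`, `(W) ⟹ A4`: the exponential-moment bound, the crude odd bound and the
  `L²` linear response are CONSEQUENCES of `EnergyWindowControl` (conjunct projections, transported
  from the representative `φ_δ` of `(W)` to every representative, resp. to `dμ_δ/dμ_T`).  So these
  three atoms lose nothing against `(W)`.  (`(W) ⟹ A3` is NOT claimed: `A3` asks the floor for EVERY
  slack rate `a > 0`, `(W)` records one; `(W) ⟹ A0` is not claimed either: `A0` has the fixed radius
  `2T`.)
* §3 `(R) ⟹ A3` directly (`e^{φ} ≥ 1 + φ ≥ 1 − C|δ|(1+H)^k ≥ 1 − C|δ|(1+H)^k e^{aH}`, any `a > 0`),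
  and `(R) ⟹ A1, A2, A4` by composition with `energyWindowControl_of_logDensityRegularity`.
  Hence EVERY open atom is implied by the hypothesis `(R)` of the record chain
  (`ClausiusBudget.stub_oddLogDensity_of_regularity`): none of them is harder than the record's open
  leaf, and jointly (with the tree theorem `A0`) they give `(W)` and `K_fix`
  (`snapshotKLUpperExpansion_of_energyWindow ∘ energyWindowControl_of_atoms`).

No new objects; no measure is constructed. [folklore throughout]
References: J.-P. Eckmann, C.-A. Pillet, L. Rey-Bellet, J. Stat. Phys. 95 (1999) 305; L. Rey-Bellet,
L. E. Thomas, Comm. Math. Phys. 225 (2002) 305; M. Hairer, A. J. Majda, Nonlinearity 23 (2010) 909.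
-/

noncomputable section

namespace Summit.AtomisticToContinuum.FouriersLaw.Theorems.ExtensiveSnapshotIrreversibility.EnergyWindow

open MeasureTheory Filter Topology InformationTheory Real
open scoped ENNReal NNReal
open Literature.MathematicalPhysics.KineticTheory.HeatConduction
-- landing revision (as in the landed `…EnergyWindowTree` / `…EnergyWindow`): the seat namespace `Tree` of re-proved tree lemmas is gone;
-- the originals are opened instead.
open Summit.AtomisticToContinuum.FouriersLaw.Theorems.ExtensiveSnapshotIrreversibility.Negative
open Summit.AtomisticToContinuum.FouriersLaw.Theorems.ExtensiveSnapshotIrreversibility.ClausiusBudget.OddLogDensity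

variable {N : ℕ}

/-! ## 1. Uniqueness of the exponent almost everywhere; the flip and the Gibbs state -/

/-- **Two measurable exponents representing the same measure agree a.e.**: if
`μ₀ · e^{φ} = μ₀ · e^{ψ}` (`withDensity`, `μ₀` σ-finite) then `φ = ψ` `μ₀`-a.e. (both sides are the
Radon–Nikodym derivative of the common measure; `ENNReal.ofReal ∘ exp` is injective). [folklore] -/
theorem ae_eq_of_withDensity_exp_eq {μ₀ : Measure (PhaseSpace N)} [SigmaFinite μ₀]
    {φ ψ : PhaseSpace N → ℝ} (hφ : Measurable φ) (hψ : Measurable ψ)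
    (h : μ₀.withDensity (fun x => ENNReal.ofReal (exp (φ x))) =
      μ₀.withDensity (fun x => ENNReal.ofReal (exp (ψ x)))) :
    φ =ᵐ[μ₀] ψ := by
  have h1 := Measure.rnDeriv_withDensity μ₀ hφ.exp.ennreal_ofReal
  have h2 := Measure.rnDeriv_withDensity μ₀ hψ.exp.ennreal_ofReal
  rw [h] at h1
  filter_upwards [h1, h2] with x hx1 hx2
  have e : ENNReal.ofReal (exp (φ x)) = ENNReal.ofReal (exp (ψ x)) := hx1.symm.trans hx2
  have e' : exp (φ x) = exp (ψ x) := by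
    have h3 := congrArg ENNReal.toReal e
    rwa [ENNReal.toReal_ofReal (exp_pos _).le, ENNReal.toReal_ofReal (exp_pos _).le] at h3
  exact Real.exp_eq_exp.1 e'

/-- The momentum flip is quasi-measure-preserving for the Gibbs state of the pinned chain
(indeed measure-preserving: `gibbsMeasure_map_flip`). [folklore] -/
theorem quasiMeasurePreserving_flip_gibbsMeasure (ω₂ lam β γ : ℝ) (N : ℕ) (T : ℝ) :
    Measure.QuasiMeasurePreserving (fun x : PhaseSpace N => (x.1, -x.2))
      ((pinnedChain ω₂ lam β γ).gibbsMeasure N T) ((pinnedChain ω₂ lam β γ).gibbsMeasure N T) := by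
  refine ⟨measurable_flip, fun s hs => ?_⟩
  rw [gibbsMeasure_map_flip (pinnedChain ω₂ lam β γ) N T]
  exact hs

/-- For two representatives `ψ`, `φ` of the same reweighting of the Gibbs state, `ψ = φ` AND
`ψ ∘ Θ = φ ∘ Θ` hold simultaneously `μ_T`-a.e. [folklore] -/
theorem ae_eq_and_flip_of_withDensity_exp_eq (ω₂ lam β γ : ℝ) (N : ℕ) (T : ℝ)
    [SigmaFinite ((pinnedChain ω₂ lam β γ).gibbsMeasure N T)]
    {φ ψ : PhaseSpace N → ℝ} (hφ : Measurable φ) (hψ : Measurable ψ)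
    (h : ((pinnedChain ω₂ lam β γ).gibbsMeasure N T).withDensity (fun x => ENNReal.ofReal (exp (ψ x))) =
      ((pinnedChain ω₂ lam β γ).gibbsMeasure N T).withDensity (fun x => ENNReal.ofReal (exp (φ x)))) :
    ∀ᵐ x ∂((pinnedChain ω₂ lam β γ).gibbsMeasure N T),
      ψ x = φ x ∧ ψ (x.1, -x.2) = φ (x.1, -x.2) := by
  have hae : ∀ᵐ x ∂((pinnedChain ω₂ lam β γ).gibbsMeasure N T), ψ x = φ x :=
    ae_eq_of_withDensity_exp_eq hψ hφ h
  have hae' : ∀ᵐ x ∂((pinnedChain ω₂ lam β γ).gibbsMeasure N T), ψ (x.1, -x.2) = φ (x.1, -x.2) :=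
    (quasiMeasurePreserving_flip_gibbsMeasure ω₂ lam β γ N T).ae hae
  filter_upwards [hae, hae'] with x hx hx'
  exact ⟨hx, hx'⟩

/-! ## 2. Three atoms are consequences of `(W)` -/

/-- **`(W) ⟹ A1`**: the exponential-moment clause `(T1)` of `EnergyWindowControl` is the atom
`NessExpMomentBound` (projection). [folklore] -/
theorem nessExpMomentBound_of_energyWindowControl (hW : EnergyWindowControl) : NessExpMomentBound := by
  intro ω₂ lam β γ hω hl hβ hγ hU μ hμ T hT N hN
  obtain ⟨δ₀, θ, a, C₁, C₂, C₃, k, m, hδ₀, hθ, h12a, φ, g₀, hφm, hW0, hT1, hT2, hB1, hB2⟩ :=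
    hW ω₂ lam β γ hω hl hβ hγ hU μ hμ T hT N hN
  exact ⟨δ₀, θ, C₁, hδ₀, hθ, fun δ hδ hδ' => hT1 δ hδ hδ'⟩

/-- **`(W) ⟹ A2`**: the crude odd bound `(T2o)` for the representative `φ_δ` of `(W)` transfers to
EVERY measurable representative `ψ` of `μ_{N,T+δ/2,T−δ/2} = μ_T · e^{ψ}` almost everywhere
(`ψ = φ_δ` and `ψ ∘ Θ = φ_δ ∘ Θ` a.e., the flip preserving `μ_T`). [folklore] -/
theorem nessOddLogRatioBound_of_energyWindowControl (hW : EnergyWindowControl) :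
    NessOddLogRatioBound := by
  intro ω₂ lam β γ hω hl hβ hγ hU μ hμ T hT N hN
  obtain ⟨δ₀, θ, a, C₁, C₂, C₃, k, m, hδ₀, hθ, h12a, φ, g₀, hφm, hW0, hT1, hT2, hB1, hB2⟩ :=
    hW ω₂ lam β γ hω hl hβ hγ hU μ hμ T hT N hN
  haveI : IsProbabilityMeasure ((pinnedChain ω₂ lam β γ).gibbsMeasure N T) :=
    pinnedChain_isProbabilityMeasure_gibbsMeasure hω hl.le hβ.le γ N hT
  refine ⟨δ₀, C₂, k, hδ₀, fun δ hδ hδ' ψ hψm hψ => ?_⟩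
  have h := ae_eq_and_flip_of_withDensity_exp_eq ω₂ lam β γ N T (hφm δ) hψm
    (hψ.symm.trans (hW0 δ hδ hδ'))
  filter_upwards [h] with x hx
  rw [hx.1, hx.2]
  exact hT2 δ hδ' x

/-- **`(W) ⟹ A4`**: the `L²` linear response `(B2)` of `(W)` is stated for `(e^{φ_δ} − 1)/δ`; since
`dμ_{N,T+δ/2,T−δ/2}/dμ_T = e^{φ_δ}` a.e. (`Measure.rnDeriv_withDensity`) it is the atom
`NessLinearResponseL2` (same `δ₀`, same `g₀`). [folklore] -/
theorem nessLinearResponseL2_of_energyWindowControl (hW : EnergyWindowControl) :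
    NessLinearResponseL2 := by
  intro ω₂ lam β γ hω hl hβ hγ hU μ hμ T hT N hN
  obtain ⟨δ₀, θ, a, C₁, C₂, C₃, k, m, hδ₀, hθ, h12a, φ, g₀, hφm, hW0, hT1, hT2, hB1, hg₀, hB2m, hB2t⟩ :=
    hW ω₂ lam β γ hω hl hβ hγ hU μ hμ T hT N hN
  set μT : Measure (PhaseSpace N) := (pinnedChain ω₂ lam β γ).gibbsMeasure N T with hμTdef
  haveI : IsProbabilityMeasure μT :=
    pinnedChain_isProbabilityMeasure_gibbsMeasure hω hl.le hβ.le γ N hT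
  -- the Radon–Nikodym derivative is `e^{φ δ}` a.e.
  have hrn : ∀ δ : ℝ, δ ≠ 0 → |δ| < δ₀ →
      (fun x => ((((μ N (T + δ / 2) (T - δ / 2)).rnDeriv μT) x).toReal - 1) / δ) =ᵐ[μT]
        fun x => (exp (φ δ x) - 1) / δ := by
    intro δ hδ hδ'
    have hmeas : Measurable fun x => ENNReal.ofReal (exp (φ δ x)) := (hφm δ).exp.ennreal_ofReal
    have h := Measure.rnDeriv_withDensity μT hmeas
    rw [← hW0 δ hδ hδ'] at h
    filter_upwards [h] with x hx
    rw [hx, ENNReal.toReal_ofReal (exp_pos _).le]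
  refine ⟨δ₀, hδ₀, g₀, hg₀, fun δ hδ hδ' => (memLp_congr_ae (hrn δ hδ hδ')).2 (hB2m δ hδ hδ'), ?_⟩
  refine hB2t.congr' ?_
  filter_upwards [eventually_ne_and_abs_lt hδ₀] with δ hδ
  refine integral_congr_ae ?_
  filter_upwards [hrn δ hδ.1 hδ.2] with x hx
  rw [hx]

/-- **`(W) ⟹ A1 ∧ A2 ∧ A4`** (summary of §2). [folklore] -/
theorem atoms₁₂₄_of_energyWindowControl (hW : EnergyWindowControl) :
    NessExpMomentBound ∧ NessOddLogRatioBound ∧ NessLinearResponseL2 :=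
  ⟨nessExpMomentBound_of_energyWindowControl hW, nessOddLogRatioBound_of_energyWindowControl hW,
    nessLinearResponseL2_of_energyWindowControl hW⟩

/-! ## 3. Every atom is a consequence of the regularity package of record `(R)` -/

/-- **`(R) ⟹ A3`** (every slack rate `a > 0`; `C₃ = max C 0`, `m = k`, the same `δ₀`): for any
representative `ψ` of the reweighting, a.e. `ψ = φ_δ`, and
`e^{φ_δ} ≥ 1 + φ_δ ≥ 1 − C|δ|(1+H)^k ≥ 1 − (max C 0)|δ|(1+H)^k e^{aH}` (`H ≥ 0`). [folklore] -/
theorem nessDensityFloor_of_logDensityRegularity (hR : LogDensityRegularity) : NessDensityFloor := by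
  intro ω₂ lam β γ hω hl hβ hγ hU μ hμ T hT N hN a ha
  obtain ⟨δ₀, η, C, k, hδ₀, hη, hη4, φ, h₀, hφm, hh₀m, hR1, hR2, hR3, hR4⟩ :=
    hR ω₂ lam β γ hω hl hβ hγ hU μ hμ T hT N hN
  haveI : IsProbabilityMeasure ((pinnedChain ω₂ lam β γ).gibbsMeasure N T) :=
    pinnedChain_isProbabilityMeasure_gibbsMeasure hω hl.le hβ.le γ N hT
  have hH0 : ∀ x, 0 ≤ (pinnedChain ω₂ lam β γ).hamiltonian N x :=
    pinnedChain_hamiltonian_nonneg hω.le hl.le hβ.le γ N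
  refine ⟨δ₀, max C 0, k, hδ₀, fun δ hδ hδ' ψ hψm hψ => ?_⟩
  have hae : ∀ᵐ x ∂((pinnedChain ω₂ lam β γ).gibbsMeasure N T), ψ x = φ δ x :=
    ae_eq_of_withDensity_exp_eq hψm (hφm δ) (hψ.symm.trans (hR1 δ hδ hδ'))
  filter_upwards [hae] with x hx
  rw [hx]
  have h1 : 0 ≤ (1 + (pinnedChain ω₂ lam β γ).hamiltonian N x) ^ k :=
    pow_nonneg (by linarith [hH0 x]) _
  have h3 : -(C * |δ| * (1 + (pinnedChain ω₂ lam β γ).hamiltonian N x) ^ k) ≤ φ δ x :=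
    (abs_le.1 (hR3 δ hδ' x)).1
  have hC : C * |δ| * (1 + (pinnedChain ω₂ lam β γ).hamiltonian N x) ^ k ≤
      max C 0 * |δ| * (1 + (pinnedChain ω₂ lam β γ).hamiltonian N x) ^ k :=
    mul_le_mul_of_nonneg_right (mul_le_mul_of_nonneg_right (le_max_left _ _) (abs_nonneg _)) h1
  have hnn : 0 ≤ max C 0 * |δ| * (1 + (pinnedChain ω₂ lam β γ).hamiltonian N x) ^ k :=
    mul_nonneg (mul_nonneg (le_max_right _ _) (abs_nonneg _)) h1
  have hexp1 : 1 ≤ exp (a * (pinnedChain ω₂ lam β γ).hamiltonian N x) :=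
    one_le_exp (mul_nonneg ha.le (hH0 x))
  have h4 : max C 0 * |δ| * (1 + (pinnedChain ω₂ lam β γ).hamiltonian N x) ^ k ≤
      max C 0 * |δ| * (1 + (pinnedChain ω₂ lam β γ).hamiltonian N x) ^ k *
        exp (a * (pinnedChain ω₂ lam β γ).hamiltonian N x) :=
    le_mul_of_one_le_right hnn hexp1
  have h5 : φ δ x + 1 ≤ exp (φ δ x) := add_one_le_exp _
  linarith

/-- **`(R) ⟹ A1`** (composition with `(R) ⟹ (W)`). [folklore] -/
theorem nessExpMomentBound_of_logDensityRegularity (hR : LogDensityRegularity) : NessExpMomentBound :=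
  nessExpMomentBound_of_energyWindowControl (energyWindowControl_of_logDensityRegularity hR)

/-- **`(R) ⟹ A2`** (composition with `(R) ⟹ (W)`; constants `C₂ = 2η`, `k = 1`). [folklore] -/
theorem nessOddLogRatioBound_of_logDensityRegularity (hR : LogDensityRegularity) :
    NessOddLogRatioBound :=
  nessOddLogRatioBound_of_energyWindowControl (energyWindowControl_of_logDensityRegularity hR)

/-- **`(R) ⟹ A4`** (composition with `(R) ⟹ (W)`; `g₀ = h₀`). [folklore] -/
theorem nessLinearResponseL2_of_logDensityRegularity (hR : LogDensityRegularity) :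
    NessLinearResponseL2 :=
  nessLinearResponseL2_of_energyWindowControl (energyWindowControl_of_logDensityRegularity hR)

/-- **`(R) ⟹ A1 ∧ A2 ∧ A3 ∧ A4`**: every atom filed in `…EnergyWindowAtoms` other than `A0` (a
result already in the tree) is a consequence of the regularity package of record. [folklore] -/
theorem atoms_of_logDensityRegularity (hR : LogDensityRegularity) :
    NessExpMomentBound ∧ NessOddLogRatioBound ∧ NessDensityFloor ∧ NessLinearResponseL2 :=
  ⟨nessExpMomentBound_of_logDensityRegularity hR, nessOddLogRatioBound_of_logDensityRegularity hR,
    nessDensityFloor_of_logDensityRegularity hR, nessLinearResponseL2_of_logDensityRegularity hR⟩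

/-- **The sandwich** `A0 → (R) → (W)` through the atoms: with the tree theorem `A0`, the regularity
package gives `(W)` VIA the atoms junction (so the junction is at most as hard as `(R)`).
[folklore] -/
theorem energyWindowControl_of_reweighting_of_logDensityRegularity (h0 : NessGibbsReweighting)
    (hR : LogDensityRegularity) : EnergyWindowControl :=
  energyWindowControl_of_atoms h0 (nessExpMomentBound_of_logDensityRegularity hR)
    (nessOddLogRatioBound_of_logDensityRegularity hR) (nessDensityFloor_of_logDensityRegularity hR)
    (nessLinearResponseL2_of_logDensityRegularity hR)

end Summit.AtomisticToContinuum.FouriersLaw.Theorems.ExtensiveSnapshotIrreversibility.EnergyWindow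

end
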